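import Literature.MathematicalPhysics.AQFT.OffDiagonalFlatDecay
import Literature.MathematicalPhysics.QuantumLattice.SchwartzPartition
import Literature.MathematicalPhysics.AQFT.OSAxiomsSchwinger
import HarnessLib

/-!
# `PencilRigidity.NPointIsotropy`, line `complex-rotation-bandlimit`: diagonal cut-offs of flat test functions

Stub `offDiagCutoffTendsto` (A2 of wave 2) of crux `stmt-QuantumFields-11686`
(`Summit.QuantumFields.YangMills.Theses.PencilRigidity.NPointIsotropy`), line
`complex-rotation-bandlimit` (lead c1).

Informal statement. Let `F ∈ ⁰𝒮((ℝ⁴)ⁿ)` be a Schwartz `n`-point test function flat on the coincidence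
locus `A = {x | ∃ i ≠ j, xᵢ = xⱼ}` (`IsOffDiagonal F`: all derivatives of `F` vanish on `A`), and let
`ψ_k` be smooth cut-offs with `ψ_k(x) = 1` as soon as all pairwise distances `‖xᵢ - xⱼ‖` are
`≥ 2/(k+1)` and `‖D^l ψ_k‖_∞ ≤ C_l (k+1)^l`. Then `ψ_k F → F` in the Schwartz topology.

Proof. By Leibniz, `D^b((ψ_k - 1)F) = Σ_c (b choose c) D^c(ψ_k - 1) ⊗ D^{b-c} F`. At a point `x`
where all pairs are at distance `> 2/(k+1)` the factor `ψ_k - 1` vanishes identically near `x`, so the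
derivative vanishes. Otherwise some pair `i ≠ j` has `‖xᵢ - xⱼ‖ ≤ 2/(k+1) ≤ 1`, and the point
`z = x` with `xⱼ` replaced by `xᵢ` lies on `A` at sup-distance `‖xᵢ - xⱼ‖` from `x`. Taylor's formula
at `z` for `D^m F` (whose Taylor polynomial vanishes identically, `F` being flat on `A`) with the
Schwartz decay of `D^{m+b+1} F` along the segment `[z, x]` gives the weighted flatness bound
`(1 + ‖x‖)^a ‖D^m F(x)‖ ≤ 4^a ‖F‖_{a, 2b+1} ‖x - z‖^{b+1}`, while `‖D^c(ψ_k - 1)(x)‖ ≤ (C_c + 1)(k+1)^b`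
for `c ≤ b`. Hence `‖x‖^a ‖D^b((ψ_k - 1)F)(x)‖ ≤ K_{a,b}(F) (k+1)^b (2/(k+1))^{b+1} = K'/(k+1) → 0`,
i.e. every Schwartz seminorm of `ψ_k F - F` tends to zero. References: folklore (the density of
`C_c^∞(Ω)` in the flat Schwartz functions; L. Hörmander, The Analysis of Linear Partial Differential
Operators I, Lemma 7.1.8, and K. Osterwalder, R. Schrader, Comm. Math. Phys. 31 (1973) §2). [folklore]
-/

noncomputable section

open scoped SchwartzMap ContDiff Topology Nat
open Set Filter
open Literature.MathematicalPhysics.AQFT Literature.MathematicalPhysics.QuantumLattice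

namespace Summit.QuantumFields.YangMills.Theorems.NPointIsotropy.ComplexRotationBandlimit

/-! ## Weighted flatness of all derivatives of a `⁰𝒮` function at the coincidence locus -/

variable {E : Type*} [NormedAddCommGroup E] [NormedSpace ℝ E] {n : ℕ}

/-- **Weighted flatness of derivatives.** For `F ∈ ⁰𝒮(Eⁿ)`, a coincident point `z`, a point `y` with
`‖y - z‖ ≤ 1` and orders `m + (M + 1) ≤ p`:
`(1 + ‖y‖)^a ‖D^m F(y)‖ ≤ 4^a · sup_{(a', p') ≤ (a, p)} ‖F‖_{a', p'} · ‖y - z‖^{M+1}` — Taylor's formula at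
`z` for `D^m F`, whose Taylor polynomial vanishes identically, with the Schwartz decay of `D^{m+M+1} F`
along the segment (`1 + ‖y‖ ≤ 2 (1 + ‖w‖)` for `w ∈ [z, y]`). [folklore] -/
theorem one_add_pow_mul_norm_iteratedFDeriv_le {F : 𝓢((Fin n → E), ℂ)} (hF : IsOffDiagonal F)
    {z y : Fin n → E} (hz : z ∈ coincidenceLocus n E) (hyz : ‖y - z‖ ≤ 1) (a : ℕ) {m M p : ℕ}
    (hp : m + (M + 1) ≤ p) :
    (1 + ‖y‖) ^ a * ‖iteratedFDeriv ℝ m F y‖ ≤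
      4 ^ a * (Finset.Iic (a, p)).sup (schwartzSeminormFamily ℂ (Fin n → E) ℂ) F *
        ‖y - z‖ ^ (M + 1) := by
  set T := (Finset.Iic (a, p)).sup (schwartzSeminormFamily ℂ (Fin n → E) ℂ) F with hT
  have hT0 : 0 ≤ T := apply_nonneg _ _
  have hy0 : 0 < (1 + ‖y‖) ^ a := by positivity
  have hsm : ContDiff ℝ ∞ (iteratedFDeriv ℝ m (F : (Fin n → E) → ℂ)) :=
    contDiff_infty.2 fun k => (F.smooth ⊤).iteratedFDeriv_right (by exact_mod_cast le_top)
  -- `‖D^k (D^l F)‖ = ‖D^{l+k} F‖`: currying is an isometry (argument adapted from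
  -- `Summit.QuantumFields.YangMills.Theorems.CurvatureKernel.norm_iteratedFDeriv_iteratedFDeriv`)
  have hDD : ∀ (k l : ℕ) (w : Fin n → E),
      ‖iteratedFDeriv ℝ k (iteratedFDeriv ℝ l (F : (Fin n → E) → ℂ)) w‖ =
        ‖iteratedFDeriv ℝ (l + k) F w‖ := by
    intro k
    induction k with
    | zero => intro l w; simp
    | succ k ih =>
      intro l w
      rw [← norm_iteratedFDeriv_fderiv, fderiv_iteratedFDeriv,
        LinearIsometryEquiv.norm_iteratedFDeriv_comp_left, ih (l + 1), Nat.add_right_comm,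
        Nat.add_assoc]
  have h0 : ∀ k ≤ M, iteratedFDeriv ℝ k (iteratedFDeriv ℝ m (F : (Fin n → E) → ℂ)) z = 0 := by
    intro k _
    have h := hDD k m z
    rw [hF z hz (m + k), norm_zero] at h
    exact norm_eq_zero.1 h
  -- bound on `D^{M+1} (D^m F)` along the segment `[z, y]`
  have hC : ∀ t ∈ Icc (0 : ℝ) 1, ‖iteratedFDeriv ℝ (M + 1)
      (iteratedFDeriv ℝ m (F : (Fin n → E) → ℂ)) (z + t • (y - z))‖ ≤ 4 ^ a * T / (1 + ‖y‖) ^ a := by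
    intro t ht
    set w := z + t • (y - z) with hw
    rw [hDD]
    have h1 : (1 + ‖w‖) ^ a * ‖iteratedFDeriv ℝ (m + (M + 1)) F w‖ ≤ 2 ^ a * T :=
      SchwartzMap.one_add_le_sup_seminorm_apply (𝕜 := ℂ) (m := (a, p)) le_rfl hp F w
    have hyw : 1 + ‖y‖ ≤ 2 * (1 + ‖w‖) := by
      have : y = w + (1 - t) • (y - z) := by rw [hw]; module
      have hn : ‖y‖ ≤ ‖w‖ + 1 := by
        calc ‖y‖ = ‖w + (1 - t) • (y - z)‖ := by rw [← this]
          _ ≤ ‖w‖ + ‖(1 - t) • (y - z)‖ := norm_add_le _ _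
          _ ≤ ‖w‖ + 1 := by
              rw [norm_smul, Real.norm_of_nonneg (by linarith [ht.2])]
              nlinarith [ht.1, ht.2, norm_nonneg (y - z)]
      linarith [norm_nonneg w]
    have hpow : (1 + ‖y‖) ^ a ≤ 2 ^ a * (1 + ‖w‖) ^ a := by
      rw [← mul_pow]; exact pow_le_pow_left₀ (by positivity) hyw a
    rw [le_div_iff₀ hy0]
    calc ‖iteratedFDeriv ℝ (m + (M + 1)) F w‖ * (1 + ‖y‖) ^ a
        ≤ ‖iteratedFDeriv ℝ (m + (M + 1)) F w‖ * (2 ^ a * (1 + ‖w‖) ^ a) :=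
          mul_le_mul_of_nonneg_left hpow (norm_nonneg _)
      _ = 2 ^ a * ((1 + ‖w‖) ^ a * ‖iteratedFDeriv ℝ (m + (M + 1)) F w‖) := by ring
      _ ≤ 2 ^ a * (2 ^ a * T) := mul_le_mul_of_nonneg_left h1 (by positivity)
      _ = 4 ^ a * T := by rw [← mul_assoc, ← mul_pow]; norm_num
  have h := norm_le_of_iteratedFDeriv_eq_zero (M := M)
    (fun t _ => hsm.contDiffAt.of_le (by exact_mod_cast le_top)) h0 hC
  rw [add_sub_cancel] at h
  have hfact : (1 : ℝ) ≤ M ! := by exact_mod_cast Nat.one_le_iff_ne_zero.2 (Nat.factorial_ne_zero M)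
  rw [mul_comm, ← le_div_iff₀ hy0]
  calc ‖iteratedFDeriv ℝ m F y‖
      ≤ 4 ^ a * T / (1 + ‖y‖) ^ a * ‖y - z‖ ^ (M + 1) / M ! := h
    _ ≤ 4 ^ a * T / (1 + ‖y‖) ^ a * ‖y - z‖ ^ (M + 1) := div_le_self (by positivity) hfact
    _ = 4 ^ a * T * ‖y - z‖ ^ (M + 1) / (1 + ‖y‖) ^ a := by ring

/-! ## The pointwise Leibniz–Taylor estimate for one cut-off -/

/-- **Pointwise estimate.** Let `F ∈ ⁰𝒮(Eⁿ)`, `κ ≥ 2`, and let `W : Eⁿ → ℂ` be smooth with `W(x) = 1`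
whenever all pairwise distances of `x` are `≥ 2/κ` and `‖D^l W‖ ≤ C_l κ^l`. Then for all `a, b` and
all `x`, `‖x‖^a ‖D^b((W - 1) F)(x)‖ ≤ K_{a,b}(C, F) / κ` with the explicit constant
`K = (Σ_{c ≤ b} (b choose c)(C_c + 1)) · 2^{b+1} 4^a sup_{≤ (a, 2b+1)} ‖F‖`: where all pairs are
`> 2/κ` apart the function `(W - 1) F` vanishes near `x`; otherwise Leibniz, the derivative bounds of
`W - 1` and the weighted flatness of `D^{b-c} F` at the coincident point obtained from `x` by merging
the close pair. [folklore] -/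
theorem pow_mul_norm_iteratedFDeriv_sub_one_smul_le {F : 𝓢((Fin n → E), ℂ)} (hF : IsOffDiagonal F)
    {C : ℕ → ℝ} (hC0 : ∀ l, 0 ≤ C l) (a b : ℕ) {W : (Fin n → E) → ℂ} {κ : ℝ} (hκ : 2 ≤ κ)
    (hW : ContDiff ℝ ∞ W) (hW1 : ∀ x, (∀ i j : Fin n, i ≠ j → 2 / κ ≤ ‖x i - x j‖) → W x = 1)
    (hWC : ∀ l x, ‖iteratedFDeriv ℝ l W x‖ ≤ C l * κ ^ l) (x : Fin n → E) :
    ‖x‖ ^ a * ‖iteratedFDeriv ℝ b (fun y => (W y - 1) • F y) x‖ ≤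
      (∑ c ∈ Finset.range (b + 1), (b.choose c : ℝ) * (C c + 1)) * (2 ^ (b + 1) * 4 ^ a *
        (Finset.Iic (a, 2 * b + 1)).sup (schwartzSeminormFamily ℂ (Fin n → E) ℂ) F) / κ := by
  set T := (Finset.Iic (a, 2 * b + 1)).sup (schwartzSeminormFamily ℂ (Fin n → E) ℂ) F with hT
  have hT0 : 0 ≤ T := apply_nonneg _ _
  have hκ0 : 0 < κ := by linarith
  have hκ1 : (1 : ℝ) ≤ κ := by linarith
  have hB0 : 0 ≤ ∑ c ∈ Finset.range (b + 1), (b.choose c : ℝ) * (C c + 1) :=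
    Finset.sum_nonneg fun c _ => by have := hC0 c; positivity
  by_cases hx : ∃ i j : Fin n, i ≠ j ∧ ‖x i - x j‖ ≤ 2 / κ
  · obtain ⟨i, j, hij, hxij⟩ := hx
    -- merge the close pair: a coincident point at sup-distance `‖x i - x j‖ ≤ 2/κ ≤ 1`
    obtain ⟨z, hzA, hxz⟩ : ∃ z ∈ coincidenceLocus n E, ‖x - z‖ ≤ 2 / κ :=
      ⟨_, update_mem_coincidenceLocus hij x, by rwa [norm_sub_update_eq, norm_sub_rev]⟩
    have h2κ : 2 / κ ≤ 1 := by rw [div_le_one hκ0]; exact hκ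
    have hxz1 : ‖x - z‖ ≤ 1 := hxz.trans h2κ
    -- derivative bounds for `W - 1`
    have hDW : ∀ c ≤ b, ‖iteratedFDeriv ℝ c (fun y => W y - 1) x‖ ≤ (C c + 1) * κ ^ b := by
      intro c hc
      have hsub : (fun y => W y - 1) = W - fun _ => (1 : ℂ) := rfl
      rw [hsub, iteratedFDeriv_sub_apply (hW.of_le (mod_cast le_top)).contDiffAt contDiffAt_const]
      refine (norm_sub_le _ _).trans ?_
      have h1 : ‖iteratedFDeriv ℝ c (fun _ : Fin n → E => (1 : ℂ)) x‖ ≤ 1 := by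
        rcases Nat.eq_zero_or_pos c with rfl | hc'
        · rw [norm_iteratedFDeriv_zero]; simp
        · rw [iteratedFDeriv_const_of_ne (Nat.pos_iff_ne_zero.1 hc')]; simp
      have hκc : κ ^ c ≤ κ ^ b := pow_le_pow_right₀ hκ1 hc
      have hκb : (1 : ℝ) ≤ κ ^ b := one_le_pow₀ hκ1
      calc ‖iteratedFDeriv ℝ c W x‖ + ‖iteratedFDeriv ℝ c (fun _ : Fin n → E => (1 : ℂ)) x‖
          ≤ C c * κ ^ c + 1 := add_le_add (hWC c x) h1
        _ ≤ C c * κ ^ b + 1 * κ ^ b :=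
            add_le_add (mul_le_mul_of_nonneg_left hκc (hC0 c)) (by linarith)
        _ = (C c + 1) * κ ^ b := by ring
    -- weighted flatness of the derivatives of `F` at `x`
    have hDF : ∀ m ≤ b, ‖x‖ ^ a * ‖iteratedFDeriv ℝ m F x‖ ≤ 4 ^ a * T * (2 / κ) ^ (b + 1) := by
      intro m hm
      calc ‖x‖ ^ a * ‖iteratedFDeriv ℝ m F x‖ ≤ (1 + ‖x‖) ^ a * ‖iteratedFDeriv ℝ m F x‖ := by
            gcongr; exact le_add_of_nonneg_left zero_le_one
        _ ≤ 4 ^ a * T * ‖x - z‖ ^ (b + 1) :=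
            one_add_pow_mul_norm_iteratedFDeriv_le hF hzA hxz1 a (m := m) (M := b)
              (p := 2 * b + 1) (by omega)
        _ ≤ 4 ^ a * T * (2 / κ) ^ (b + 1) := by gcongr
    -- Leibniz
    have hsm1 : ContDiff ℝ ∞ (fun y => W y - 1) := hW.sub contDiff_const
    have hleib := norm_iteratedFDeriv_smul_le (𝕜 := ℝ) hsm1 (F.smooth ⊤) x (n := b)
      (mod_cast le_top)
    have hκne : κ ≠ 0 := hκ0.ne'
    have hkey : κ ^ b * (2 / κ) ^ (b + 1) = 2 ^ (b + 1) / κ := by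
      rw [div_pow, pow_succ κ b, ← mul_div_assoc, mul_div_mul_left _ _ (pow_ne_zero b hκne)]
    calc ‖x‖ ^ a * ‖iteratedFDeriv ℝ b (fun y => (W y - 1) • F y) x‖
        ≤ ‖x‖ ^ a * ∑ c ∈ Finset.range (b + 1), (b.choose c : ℝ) *
            ‖iteratedFDeriv ℝ c (fun y => W y - 1) x‖ * ‖iteratedFDeriv ℝ (b - c) F x‖ := by
          gcongr
      _ = ∑ c ∈ Finset.range (b + 1), (b.choose c : ℝ) *
            ‖iteratedFDeriv ℝ c (fun y => W y - 1) x‖ * (‖x‖ ^ a * ‖iteratedFDeriv ℝ (b - c) F x‖) := by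
          rw [Finset.mul_sum]
          exact Finset.sum_congr rfl fun c _ => by ring
      _ ≤ ∑ c ∈ Finset.range (b + 1), (b.choose c : ℝ) * ((C c + 1) * κ ^ b) *
            (4 ^ a * T * (2 / κ) ^ (b + 1)) := by
          refine Finset.sum_le_sum fun c hc => ?_
          have hcb : c ≤ b := Nat.lt_succ_iff.mp (Finset.mem_range.mp hc)
          have := hC0 c
          exact mul_le_mul (mul_le_mul_of_nonneg_left (hDW c hcb) (by positivity))
            (hDF (b - c) (Nat.sub_le b c)) (by positivity) (by positivity)
      _ = (∑ c ∈ Finset.range (b + 1), (b.choose c : ℝ) * (C c + 1)) *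
            (κ ^ b * (2 / κ) ^ (b + 1)) * (4 ^ a * T) := by
          rw [Finset.sum_mul, Finset.sum_mul]
          exact Finset.sum_congr rfl fun c _ => by ring
      _ = (∑ c ∈ Finset.range (b + 1), (b.choose c : ℝ) * (C c + 1)) *
            (2 ^ (b + 1) * 4 ^ a * T) / κ := by
          rw [hkey]; ring
  · -- all pairs are `> 2/κ` apart: `W = 1` near `x`, the derivative vanishes at `x`
    push Not at hx
    have hev : ∀ᶠ y in 𝓝 x, ∀ i j : Fin n, i ≠ j → 2 / κ ≤ ‖y i - y j‖ := by
      simp only [eventually_all]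
      intro i j hij
      have hc : Continuous fun y : Fin n → E => ‖y i - y j‖ := by fun_prop
      exact ((hc.tendsto x).eventually_const_lt (hx i j hij)).mono fun _ hy => hy.le
    have hg0 : (fun y => (W y - 1) • F y) =ᶠ[𝓝 x] (0 : (Fin n → E) → ℂ) :=
      hev.mono fun y hy => by simp only [hW1 y hy, sub_self, zero_smul, Pi.zero_apply]
    rw [(hg0.iteratedFDeriv ℝ b).eq_of_nhds, iteratedFDeriv_zero, Pi.zero_apply, norm_zero,
      mul_zero]
    exact div_nonneg (mul_nonneg hB0 (by positivity)) hκ0.le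

/-! ## Convergence of the cut-off family -/

/-- **Diagonal cut-offs of a flat test function converge to it** (general real normed space `E`).
For `F ∈ ⁰𝒮(Eⁿ)` and smooth real cut-offs `ψ_k` with `ψ_k(x) = 1` whenever all pairwise distances of
`x` are `≥ 2/(k+1)` and `‖D^l ψ_k‖_∞ ≤ C_l (k+1)^l`, the Schwartz functions `ψ_k F`
(`SchwartzMap.smulLeftCLM`) converge to `F` in `𝓢`: by
`pow_mul_norm_iteratedFDeriv_sub_one_smul_le` every Schwartz seminorm of `ψ_k F - F` is `O(1/(k+1))`.
[folklore] -/
theorem tendsto_smulLeftCLM_of_isOffDiagonal {F : 𝓢((Fin n → E), ℂ)} (hF : IsOffDiagonal F)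
    (C : ℕ → ℝ) (ψ : ℕ → (Fin n → E) → ℝ) (hψs : ∀ k, ContDiff ℝ ∞ (ψ k))
    (hψ1 : ∀ (k : ℕ) (x : Fin n → E), (∀ i j : Fin n, i ≠ j → 2 / ((k : ℝ) + 1) ≤ ‖x i - x j‖) →
      ψ k x = 1)
    (hψC : ∀ (k l : ℕ) (x : Fin n → E), ‖iteratedFDeriv ℝ l (ψ k) x‖ ≤ C l * ((k : ℝ) + 1) ^ l) :
    Tendsto (fun k => SchwartzMap.smulLeftCLM ℂ (fun x => (ψ k x : ℂ)) F) atTop (𝓝 F) := by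
  have hWs : ∀ k, ContDiff ℝ ∞ (fun x => (ψ k x : ℂ)) := fun k => contDiff_ofReal_comp ℂ (hψs k)
  have hWC : ∀ k l x, ‖iteratedFDeriv ℝ l (fun x => (ψ k x : ℂ)) x‖ ≤ C l * ((k : ℝ) + 1) ^ l :=
    fun k l x => (norm_iteratedFDeriv_ofReal_comp ℂ (hψs k) l x).le.trans (hψC k l x)
  have hWt : ∀ k, (fun x => (ψ k x : ℂ)).HasTemperateGrowth := fun k =>
    hasTemperateGrowth_of_bounds (hWs k) _ (hWC k)
  have hW1 : ∀ (k : ℕ) (x : Fin n → E), (∀ i j : Fin n, i ≠ j → 2 / ((k : ℝ) + 1) ≤ ‖x i - x j‖) →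
      (ψ k x : ℂ) = 1 := fun k x hx => by rw [hψ1 k x hx, Complex.ofReal_one]
  have hC0 : ∀ l, 0 ≤ C l := fun l => by
    have h := hψC 0 l 0
    rw [Nat.cast_zero, zero_add, one_pow, mul_one] at h
    exact (norm_nonneg _).trans h
  have hcoe : ∀ k, (⇑(SchwartzMap.smulLeftCLM ℂ (fun x => (ψ k x : ℂ)) F - F) : (Fin n → E) → ℂ) =
      fun x => ((ψ k x : ℂ) - 1) • F x := by
    intro k
    funext x
    simp only [sub_apply, SchwartzMap.smulLeftCLM_apply_apply (hWt k), sub_smul, one_smul]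
  rw [(schwartz_withSeminorms ℂ (Fin n → E) ℂ).tendsto_nhds]
  rintro ⟨a, b⟩ ε hε
  set K := (∑ c ∈ Finset.range (b + 1), (b.choose c : ℝ) * (C c + 1)) * (2 ^ (b + 1) * 4 ^ a *
    (Finset.Iic (a, 2 * b + 1)).sup (schwartzSeminormFamily ℂ (Fin n → E) ℂ) F) with hK
  have hK0 : 0 ≤ K := mul_nonneg (Finset.sum_nonneg fun c _ => by have := hC0 c; positivity)
    (mul_nonneg (by positivity) (apply_nonneg _ _))
  -- the seminorm estimate `‖ψ_k F - F‖_{a,b} ≤ K / (k + 1)` for `k ≥ 1`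
  have hest : ∀ k : ℕ, 1 ≤ k →
      SchwartzMap.seminorm ℂ a b (SchwartzMap.smulLeftCLM ℂ (fun x => (ψ k x : ℂ)) F - F) ≤
        K / ((k : ℝ) + 1) := by
    intro k hk
    have hk1 : (1 : ℝ) ≤ k := by exact_mod_cast hk
    refine SchwartzMap.seminorm_le_bound ℂ a b _ (by positivity) fun x => ?_
    rw [hcoe k]
    exact pow_mul_norm_iteratedFDeriv_sub_one_smul_le hF hC0 a b (by linarith) (hWs k) (hW1 k)
      (hWC k) x
  have hlim : Tendsto (fun k : ℕ => K / ((k : ℝ) + 1)) atTop (𝓝 0) := by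
    have h := tendsto_one_div_add_atTop_nhds_zero_nat.const_mul K
    rw [mul_zero] at h
    exact h.congr fun k => by ring
  filter_upwards [eventually_ge_atTop 1, hlim.eventually_lt_const hε] with k hk hk'
  exact (hest k hk).trans_lt hk'

/-- **Stub `offDiagCutoffTendsto` (A2).** For ANY family of smooth cut-offs `ψ_k` on `(ℝ⁴)ⁿ` with values
in `[0, 1]`, equal to `1` where all pairwise distances are `≥ 2/(k+1)`, and with
`‖D^l ψ_k‖_∞ ≤ C_l (k+1)^l`, and any `F ∈ ⁰𝒮((ℝ⁴)ⁿ)` (flat on the coincidence locus), the Schwartz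
functions `u_k = ψ_k F` converge to `F` in the Schwartz topology
(`tendsto_smulLeftCLM_of_isOffDiagonal`; the `[0, 1]`-valuedness is not used). [folklore] -/
theorem offDiagCutoffTendsto : ∀ (n : ℕ) (C : ℕ → ℝ) (ψ : ℕ → (Fin n → EuclideanSpace ℝ (Fin 4)) → ℝ), (∀ k : ℕ, ContDiff ℝ (⊤ : ℕ∞) (ψ k)) → (∀ (k : ℕ) (x : (Fin n → EuclideanSpace ℝ (Fin 4))), ψ k x ∈ Set.Icc (0 : ℝ) 1) → (∀ (k : ℕ) (x : (Fin n → EuclideanSpace ℝ (Fin 4))), (∀ i j : Fin n, i ≠ j → 2 / ((k : ℝ) + 1) ≤ ‖x i - x j‖) → ψ k x = 1) → (∀ (k l : ℕ) (x : (Fin n → EuclideanSpace ℝ (Fin 4))), ‖iteratedFDeriv ℝ l (ψ k) x‖ ≤ C l * ((k : ℝ) + 1) ^ l) → ∀ F : SchwartzMap (Fin n → EuclideanSpace ℝ (Fin 4)) ℂ, Literature.MathematicalPhysics.AQFT.IsOffDiagonal F → ∃ u : ℕ → SchwartzMap (Fin n → EuclideanSpace ℝ (Fin 4)) ℂ, (∀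 (k : ℕ) (x : (Fin n → EuclideanSpace ℝ (Fin 4))), u k x = (ψ k x : ℂ) * F x) ∧ Filter.Tendsto u Filter.atTop (nhds F) := by
  intro n C ψ hψs _ hψ1 hψC F hF
  have hWt : ∀ k, (fun x => (ψ k x : ℂ)).HasTemperateGrowth := fun k =>
    hasTemperateGrowth_of_bounds (contDiff_ofReal_comp ℂ (hψs k)) (fun l => C l * ((k : ℝ) + 1) ^ l)
      fun l x => (norm_iteratedFDeriv_ofReal_comp ℂ (hψs k) l x).le.trans (hψC k l x)
  exact ⟨fun k => SchwartzMap.smulLeftCLM ℂ (fun x => (ψ k x : ℂ)) F, fun k x => by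
    rw [SchwartzMap.smulLeftCLM_apply_apply (hWt k), smul_eq_mul],
    tendsto_smulLeftCLM_of_isOffDiagonal hF C ψ hψs hψ1 hψC⟩

end Summit.QuantumFields.YangMills.Theorems.NPointIsotropy.ComplexRotationBandlimit

end
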